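import Summits.QuantumFields.QCD.Theses.PauliWegnerSea
import Literature.MathematicalPhysics.QuantumFieldTheory.QCDTimeReflection

/-!
# Sketch — crux ideas `baryon-parity-untwist` and `pressure-linear-response`
# for `PauliWegnerSea.OneScaleTrajectory` (stmt-QuantumFields-11513), round 2, ideator 4

First lemmas (typed `Prop`s over existing declarations; `LayerSupport_diag` is proved as a sanity
check). Time is coordinate `0`; the crux's `diracMatrix`/`wilsonDirac` are time-PERIODIC on the odd
torus `2S+1`; `wilsonDiracAP` (tree, `QCDTimeReflection`) is the antiperiodic twin whose sign layer
sits on the temporal links `⌊L/2⌋ → ⌊L/2⌋+1`, antipodal to the slice `t = 0`.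

## Card `baryon-parity-untwist`
* `LayerSupport` — `D_P − D_AP` is supported on the antipodal layer and equals twice the periodic
  hopping there (so `G_P − G_AP = D_P⁻¹ (D_AP − D_P) D_AP⁻¹` is a sum over layer crossings only).
* `EvenSectorDominance` — for the degenerate two-flavour weight on the physical branch `t > −1`:
  `Z_AP ≥ Z_P` and, pointwise in `n`, `N_AP(n) ≥ N_P(n)` for the unnormalised axial pion
  functionals (`N_b(n) = ∫ det(D_b)² ‖G_b(0, n e₀)‖_F²`): the differences are traces over the
  fermion-number-ODD (= baryon-number-odd, by triality) sector of a positive transfer matrix.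
* `EvenSectorLogConvexity` — `n ↦ N_P(n) + N_AP(n)` (twice the EVEN-sector trace) is log-convex on
  the time circle: the reflection-positivity consequences survive for the periodic functional up
  to the odd-sector terms, with NO retyping of the crux.

## Card `pressure-linear-response`
* `MeanPlaquetteBound` — volume-uniform weak-coupling smallness of the mean Wilson action density
  under the PHASE-QUENCHED measure, from convexity of `β ↦ log Z` and two elementary free-energy
  bounds (Remez-in-links for the fermionic factor): `E_{|w|}[S_W] ≤ C · L⁴ · (1 + log β)/β`.
* `MassConjugateIdentity` — the UV pin's first moment is a free-energy derivative:
  `d/dt log ∫ |det D(t)|^{N_f} e^{−βS_W} = N_f · E_{|w|,t}[Re tr D(t)⁻¹]`, and by translation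
  invariance of the torus functional the right side is `N_f · 12?·L⁴ ·`(per-site block trace).
-/

namespace Summit.QuantumFields.QCD.Cruxes.OneScaleTrajectory.BaryonParityUntwist

open scoped BigOperators Matrix ComplexConjugate
open MeasureTheory Filter Literature.MathematicalPhysics.QuantumFieldTheory
  Literature.MathematicalPhysics.QuantumLattice Literature.Probability.LatticeModels

attribute [local instance] Classical.propDecidable

/-- The hop `p.1 → q.1` (or `q.1 → p.1`) is a TEMPORAL hop through the antiperiodic layer
`t = ⌊L/2⌋ → ⌊L/2⌋ + 1` of `wilsonDiracAP` (`apLinkSign = −1` exactly there). [folklore] -/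
def IsLayerHop (L : ℕ) (x y : TorusSite 4 L) : Prop :=
  (y = Site.shift x 0 ∧ (x 0).val = L / 2) ∨ (x = Site.shift y 0 ∧ (y 0).val = L / 2)

/-- **Layer support of `D_P − D_AP`.** For every torus side `L`, SU(3) configuration `U` and bare
mass `m` (Wilson `r = 1`): the periodic and antiperiodic Wilson–Dirac matrices differ only in the
entries of temporal hops through the antipodal layer, where `D_P − D_AP = 2 D_P` (the AP operator
flips the sign of exactly those hops). Consequently `D_P⁻¹ − D_AP⁻¹ = D_P⁻¹ (D_AP − D_P) D_AP⁻¹` is a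
sum over layer crossings: every periodic/antiperiodic difference is made of quark lines that CROSS
the far layer — the algebraic seed of the winding (baryon-parity) decomposition. [folklore] -/
def LayerSupport : Prop :=
  ∀ (L : ℕ) [NeZero L] (U : GaugeConfig 4 L (Matrix.specialUnitaryGroup (Fin 3) ℂ)) (m : ℝ)
    (p q : TorusSite 4 L × Fin 3 × Fin 4),
    (wilsonDirac (fundamentalRep (Fin 3)) U m 1 - wilsonDiracAP (fundamentalRep (Fin 3)) U m 1) p q =
      if IsLayerHop L p.1 q.1 then 2 * wilsonDirac (fundamentalRep (Fin 3)) U m 1 p q else 0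

/-- Sanity case of `LayerSupport` (proved): the two operators have the same diagonal. [folklore] -/
theorem LayerSupport_diag (L : ℕ) [NeZero L]
    (U : GaugeConfig 4 L (Matrix.specialUnitaryGroup (Fin 3) ℂ)) (m : ℝ)
    (p : TorusSite 4 L × Fin 3 × Fin 4)
    (h : ∀ μ : Fin 4, p.1 ≠ Site.shift p.1 μ) :
    (wilsonDirac (fundamentalRep (Fin 3)) U m 1 - wilsonDiracAP (fundamentalRep (Fin 3)) U m 1) p p = 0 := by
  simp [wilsonDirac, wilsonDiracAP, Matrix.sub_apply, Matrix.of_apply, h]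

/-- The unnormalised axial pion functional of the DEGENERATE two-flavour theory at bare mass `t` on
the odd torus `2S+1`, with temporal boundary condition given by the operator `D`:
`N(n) = ∫ (det D(U))² · Σ_{a,i,b,j} |D(U)⁻¹_{(0,a,i),(n e₀,b,j)}|² dμ_W(β)` — for `D = wilsonDirac` this
is `Z_{|w|} ·` (the crux's `E_{|w|,k,S}[X(ne₀)²]`-type quantity at `s = 2`, `N_f = 2`, `m₁ = m₂`);
for `D = wilsonDiracAP` its honest-trace twin. [folklore] -/
noncomputable def pionFunctional (β : ℝ) (S : ℕ)
    (D : GaugeConfig 4 (2 * S + 1) (Matrix.specialUnitaryGroup (Fin 3) ℂ) →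
      Matrix (TorusSite 4 (2 * S + 1) × Fin 3 × Fin 4) (TorusSite 4 (2 * S + 1) × Fin 3 × Fin 4) ℂ)
    (n : ℕ) : ℝ :=
  ∫ U : GaugeConfig 4 (2 * S + 1) (Matrix.specialUnitaryGroup (Fin 3) ℂ),
    ‖(D U).det‖ ^ 2 *
      (∑ a : Fin 3, ∑ i : Fin 4, ∑ b : Fin 3, ∑ j : Fin 4,
        ‖(D U)⁻¹ (Torus.proj (2 * S + 1) 0, a, i)
            (Torus.proj (2 * S + 1) (Pi.single 0 (n : ℤ)), b, j)‖ ^ 2)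
    ∂(wilsonMeasure (fundamentalRep (Fin 3)) β)

/-- The two-flavour degenerate partition function with boundary condition `D`. [folklore] -/
noncomputable def partitionFn (β : ℝ) (S : ℕ)
    (D : GaugeConfig 4 (2 * S + 1) (Matrix.specialUnitaryGroup (Fin 3) ℂ) →
      Matrix (TorusSite 4 (2 * S + 1) × Fin 3 × Fin 4) (TorusSite 4 (2 * S + 1) × Fin 3 × Fin 4) ℂ) : ℝ :=
  ∫ U : GaugeConfig 4 (2 * S + 1) (Matrix.specialUnitaryGroup (Fin 3) ℂ),
    ‖(D U).det‖ ^ 2 ∂(wilsonMeasure (fundamentalRep (Fin 3)) β)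

/-- **Even-sector dominance (baryon-parity untwisting of the supertrace).** On the physical branch
`t > −1` (clause (i) of the crux = the printed positivity range `|κ| < 1/6` of the one-step
Wilson transfer matrix, Lüscher 1977 / Montvay–Münster (4.111)), for every `β ≥ 0`, every odd torus
`2S+1` and every `n`: the antiperiodic (honest-trace) quantities dominate the periodic (supertrace)
ones, `Z_AP ≥ Z_P` and `N_AP(n) ≥ N_P(n)`. Content: `Z_P = Tr[(−1)^F 𝕋^{2S+1}]`,
`Z_AP = Tr[𝕋^{2S+1}]`, and likewise for the numerators with the pion insertions, so
`Z_AP − Z_P = 2 Tr_{F odd}[𝕋^{2S+1}] ≥ 0`; and on gauge-invariant states `(−1)^F = (−1)^B`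
(quark number ≡ 0 mod 3 by triality), so the difference is the BARYON-number-odd sector.
[cite: Luscher1977] [cite: MontvayMunster1994, §4.1.3 (4.34), §4.2.3 (4.111)] -/
def EvenSectorDominance : Prop :=
  ∀ (β t : ℝ), 0 ≤ β → -1 < t → ∀ (S : ℕ), 1 ≤ S →
    partitionFn β S (fun U => wilsonDirac (fundamentalRep (Fin 3)) U t 1) ≤
        partitionFn β S (fun U => wilsonDiracAP (fundamentalRep (Fin 3)) U t 1) ∧
      ∀ n : ℕ, n ≤ 2 * S →
        pionFunctional β S (fun U => wilsonDirac (fundamentalRep (Fin 3)) U t 1) n ≤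
          pionFunctional β S (fun U => wilsonDiracAP (fundamentalRep (Fin 3)) U t 1) n

/-- **Even-sector log-convexity.** Same hypotheses: the SUM of the periodic and antiperiodic
unnormalised axial pion functionals, `E(n) := N_P(n) + N_AP(n) = 2 Tr_{F even}[𝕋^{2S+1−n} Ô† 𝕋ⁿ Ô]`,
is reflection-symmetric and log-convex on the time circle: `E(n)² ≤ E(n−1) E(n+1)` for
`1 ≤ n ≤ 2S`, and `E(n) = E(2S+1−n)`. This is the reflection-positivity structure that the
crux's PERIODIC typing was believed to destroy; it survives exactly, on the even sector, and the
periodic functional is `N_P = E/2 − (N_AP − N_P)/2` with the subtracted odd-sector term controlled by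
`EvenSectorDominance` and three-winding (baryon-line) upper bounds. [cite: Luscher1977] [cite: MontvayMunster1994, §4.2.3 (4.90), (4.111)] -/
def EvenSectorLogConvexity : Prop :=
  ∀ (β t : ℝ), 0 ≤ β → -1 < t → ∀ (S : ℕ), 1 ≤ S →
    let E : ℕ → ℝ := fun n =>
      pionFunctional β S (fun U => wilsonDirac (fundamentalRep (Fin 3)) U t 1) n +
        pionFunctional β S (fun U => wilsonDiracAP (fundamentalRep (Fin 3)) U t 1) n
    (∀ n : ℕ, 1 ≤ n → n ≤ 2 * S → E n ^ 2 ≤ E (n - 1) * E (n + 1)) ∧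
      ∀ n : ℕ, n ≤ 2 * S + 1 → E n = E (2 * S + 1 - n)

end Summit.QuantumFields.QCD.Cruxes.OneScaleTrajectory.BaryonParityUntwist

namespace Summit.QuantumFields.QCD.Cruxes.OneScaleTrajectory.PressureLinearResponse

open scoped BigOperators Matrix ComplexConjugate
open MeasureTheory Filter Literature.MathematicalPhysics.QuantumFieldTheory
  Literature.MathematicalPhysics.QuantumLattice Literature.Probability.LatticeModels

/-- **Mean-plaquette bound for the phase-quenched measure, uniformly in the volume.** For every
`N_f` there is `C = C(N_f)` (linear in `N_f`) such that for every bare-mass tuple in `[−2,2]^{N_f}`, every `β ≥ 2` and every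
torus side `L ≥ 2`, the `|det diracMatrix|`-weighted mean of the Wilson action is at most
`C · L⁴ · (1 + log β)/β` (i.e. `O(log β / β)` per plaquette). Mechanism: `F(β) := L⁻⁴ log ∫ |det
D(U)| e^{−β S_W(U)} dU` is CONVEX in `β`; `F(β) ≤ 12 N_f log 10` (`‖D_W‖ ≤ 10`) and
`F(β) ≥ −6βε − 16 log(1/ε) − C' ` by restricting to the `√ε`-ball of every link and a
Remez-type lower bound for the band-limited link polynomials `g ↦ det D_W(U[e ↦ g])`
(`PauliBandLimit`/`SingleLinkLogFlatness` of the route); convexity turns the two bounds into the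
derivative bound `−F'(β) = L⁻⁴ E_{|w|}[S_W] ≤ (F(β/2) − F(β))/(β/2)`. No reflection positivity, no
cluster expansion, no fibre conditioning — hence no `(1+β)^p` and no dependence on `L`. [folklore] -/
def MeanPlaquetteBound : Prop :=
  ∀ Nf : ℕ, ∃ C : ℝ, 0 < C ∧ ∀ (mq : Fin Nf → ℝ), (∀ f, -2 ≤ mq f ∧ mq f ≤ 2) →
    ∀ β : ℝ, 2 ≤ β → ∀ (L : ℕ) [NeZero L], 2 ≤ L →
      (∫ U : GaugeConfig 4 L (Matrix.specialUnitaryGroup (Fin 3) ℂ),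
          ‖(diracMatrix U mq).det‖ * wilsonAction (fundamentalRep (Fin 3)) U
          ∂(wilsonMeasure (fundamentalRep (Fin 3)) β)) /
        (∫ U : GaugeConfig 4 L (Matrix.specialUnitaryGroup (Fin 3) ℂ),
          ‖(diracMatrix U mq).det‖ ∂(wilsonMeasure (fundamentalRep (Fin 3)) β)) ≤
      C * (L : ℝ) ^ 4 * (1 + Real.log β) / β

/-- **The UV pin's first moment is a free-energy derivative (mass-conjugate identity).** For the
degenerate `N_f`-fold phase-quenched weight at bare mass `t` (any sign), any `β`, any torus side:
`t ↦ log ∫ ‖det D_W(U,t)‖^{N_f} dμ_W` is differentiable wherever the integrand's log is, with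
derivative `N_f · E_{|w|,t}[Re tr D_W(U,t)⁻¹]` (Jacobi's formula `d/dt log|det D(t)| = Re tr D(t)⁻¹`,
`∂_t D = 1`), and by translation invariance of the torus functional
`E_{|w|,t}[Re tr D⁻¹] = L⁴ · E_{|w|,t}[Re Σ_{a,i} D⁻¹_{(0,a,i),(0,a,i)}]` — the diagonal colour–spin
block at the origin, which the crux's `X(0) = Σ_{a,i,b,j}|G(0,0)_{ai,bj}|` dominates entrywise.
Stated for the normalised difference quotient (no differentiability side-conditions). [folklore] -/
def MassConjugateIdentity : Prop :=
  ∀ (Nf : ℕ) (β : ℝ) (L : ℕ) [NeZero L] (t : ℝ),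
    let Z : ℝ → ℝ := fun t' =>
      ∫ U : GaugeConfig 4 L (Matrix.specialUnitaryGroup (Fin 3) ℂ),
        ‖(wilsonDirac (fundamentalRep (Fin 3)) U t' 1).det‖ ^ Nf
        ∂(wilsonMeasure (fundamentalRep (Fin 3)) β)
    let blockTrace : ℝ :=
      (∫ U : GaugeConfig 4 L (Matrix.specialUnitaryGroup (Fin 3) ℂ),
          ‖(wilsonDirac (fundamentalRep (Fin 3)) U t 1).det‖ ^ Nf *
            (∑ a : Fin 3, ∑ i : Fin 4,
              ((wilsonDirac (fundamentalRep (Fin 3)) U t 1)⁻¹ ((0 : TorusSite 4 L), a, i)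
                ((0 : TorusSite 4 L), a, i)).re)
          ∂(wilsonMeasure (fundamentalRep (Fin 3)) β)) / Z t
    0 < Z t → HasDerivAt (fun t' => Real.log (Z t')) ((Nf : ℝ) * (L : ℝ) ^ 4 * blockTrace) t

end Summit.QuantumFields.QCD.Cruxes.OneScaleTrajectory.PressureLinearResponse
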